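import Summits.RiemannHypothesis.RiemannHypothesis.Theses.GroundBarta
import Literature.NumberTheory.LFunctions.WeilSemilocalCompactnessProofs
import Literature.NumberTheory.LFunctions.WeilGroundEnergyParitySplit

/-!
# Crux `GroundBarta.PolarPerronFrobenius` (stmt-RiemannHypothesis-18390) — line `Sketch`
# (idea `cone-obstacle-kkt`, funnel of `coupling-birth-locus`): the CONE–COMPACTNESS skeleton

Lead prover `prover-line-stmt-RiemannHypothesis-18390-0`, cycle 1 (2026-08-17).

READBACK (refuter, `Cruxes/PolarPerronFrobenius/PolarPFLogic.lean`, `polarPF_iff := Iff.rfl`):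
`PolarPerronFrobenius ↔ ∀ A, ∃ a ≥ A, (EW a → GSP a)` with `EW a` = "the even sector carries the
bottom at window `a`" and `GSP a` = "some ground state of the FULL windowed Weil form at `a` is real
and `≥ 0` a.e. on `(-a, a)`" (junk-free ∀h-eventually encoding).

THE LINE (card `Ideas/cone-obstacle-kkt.md`, Lever + first lemma `gsp_of_coneGapZero`): replace the
sign question about an EIGENFUNCTION by a DENSITY statement about smooth CONE tests — `GSP a` follows
(RH-free soft analysis: compactness of minimising sequences, CCM25 Thm 3.6, PROVED in the tree as
`ConnesConsaniMoscovici2025_thm_3_6_holds`; a.e.-closedness of the cone under `L²` limits) from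
"non-negative real window tests come within every `δ > 0` of every normalised window test's energy"
(`ε⁺(a) = ε(a)`, CONE GAP ZERO). The even-sector funnel of the route (refuter F2; card
`coupling-birth-locus`, lemma `gsp_of_gspg_two`) is kept: the RH-bearing content is stated in the EVEN
sector only (even cone tests dense among EVEN tests), and the hypothesis `EW a` + the parity split
`ε(a) = min (ε_ev(a), ε_od(a))` (`weilGroundEnergy_eq_min_even_odd`, in the tree) transport it to all
tests.

STUBS (registered; S1 is the crux proper, S2–S4 are RH-free):
* `stub_evenConeDense_cofinal` (S1, RH-bearing, XL — the lead's): beyond every height there is a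
  window at which, IF the even sector carries the bottom, THEN even cone tests are energy-dense among
  even normalised window tests (`ε⁺_ev(a) = ε_ev(a)` cofinally at even-winning windows). By F1 and the
  symmetrisation remark in NOTES.md this is EQUIVALENT in substance to the crux (no strengthening);
  it is what any even-sector mechanism (AMP window / obstacle KKT / harmonic-majorant edge source)
  must deliver.
* `stub_coneDense_of_even` (S2, RH-free, S): `EW a` + even-cone density ⇒ parity-free cone density
  (parity split of the ground energy).
* `stub_coneMinimizingSeq` (S3, RH-free, S): cone density ⇒ a normalised minimising sequence of cone
  tests (`bddBelow_weilQuadratic_sphere_holds`, `exists_weilMinimizingSeq`).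
* `stub_aeNonneg_of_L2_limit` (S4, RH-free, S/M): an `L²`-limit of pointwise real non-negative
  functions is a.e. real non-negative (convergence in measure, a.e.-convergent subsequence).
Composition `PolarPerronFrobenius_of`: S1 at height `max A 1`; S2; S3; CCM compactness extracts an
`L²`-convergent subsequence (still minimising); the two encodings of "minimising" agree on the
bounded-below sphere (`forall_eventually_le_iff_tendsto_weilGroundEnergy`, copied from the refuter's
GroundBartaFloorLogic); S4 gives the sign.
-/

set_option linter.dupNamespace false

noncomputable section

open Set MeasureTheory Filter Complex
open scoped Real Topology ComplexConjugate ENNReal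

namespace Summit.RiemannHypothesis.RiemannHypothesis.Cruxes.PolarPerronFrobenius.ConeCompactness

open Literature.NumberTheory.LFunctions
open Summit.RiemannHypothesis.RiemannHypothesis.Theses.GroundBarta

/-! ## Stub statements (`Sig.stub_*`; def-free bodies over the Literature vocabulary, fully
qualified, so that a Theorems file can restate each verbatim) -/

namespace Sig

/-- **S1 `stub_evenConeDense_cofinal`** (RH-bearing; the crux proper in cone form). Beyond every
height `A` there is a window `a ≥ A` such that IF every odd normalised window test is matched up to
any `δ > 0` by an even one (`EW a`, the window-`a` clause of `EvenWinsBeyondArch`), THEN every EVEN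
normalised window test is matched up to any `δ > 0` by an EVEN CONE test (smooth, supported in
`[-a, a]`, even, pointwise real and `≥ 0`, normalised). -/
def stub_evenConeDense_cofinal : Prop :=
  ∀ A : ℝ, ∃ a : ℝ, A ≤ a ∧
    ((∀ o : ℝ → ℂ, Literature.NumberTheory.LFunctions.IsWeilTest o → tsupport o ⊆ Set.Icc (-a) a →
          (∀ t, o (-t) = -o t) → ∫ t, ‖o t‖ ^ 2 = (1 : ℝ) → ∀ δ : ℝ, 0 < δ →
            ∃ w : ℝ → ℂ, Literature.NumberTheory.LFunctions.IsWeilTest w ∧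
              tsupport w ⊆ Set.Icc (-a) a ∧ (∀ t, w (-t) = w t) ∧ ∫ t, ‖w t‖ ^ 2 = (1 : ℝ) ∧
              (Literature.NumberTheory.LFunctions.weilQuadratic w).re ≤
                (Literature.NumberTheory.LFunctions.weilQuadratic o).re + δ) →
      ∀ h : ℝ → ℂ, Literature.NumberTheory.LFunctions.IsWeilTest h → tsupport h ⊆ Set.Icc (-a) a →
          (∀ t, h (-t) = h t) → ∫ t, ‖h t‖ ^ 2 = (1 : ℝ) → ∀ δ : ℝ, 0 < δ →
            ∃ w : ℝ → ℂ, Literature.NumberTheory.LFunctions.IsWeilTest w ∧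
              tsupport w ⊆ Set.Icc (-a) a ∧ (∀ t, w (-t) = w t) ∧
              (∀ t, (w t).im = 0 ∧ 0 ≤ (w t).re) ∧ ∫ t, ‖w t‖ ^ 2 = (1 : ℝ) ∧
              (Literature.NumberTheory.LFunctions.weilQuadratic w).re ≤
                (Literature.NumberTheory.LFunctions.weilQuadratic h).re + δ)

/-- **S2 `stub_coneDense_of_even`** (RH-free funnel). At a genuine window `a > 0` where the even
sector carries the bottom (`EW a`) and even cone tests are dense among even tests, cone tests
(smooth, supported in `[-a, a]`, pointwise real and `≥ 0`, normalised — no parity asked) are dense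
among ALL normalised window tests: parity split `ε(a) = min (ε_ev(a), ε_od(a))`
(`weilGroundEnergy_eq_min_even_odd`) and `ε_ev(a) ≤ ε_od(a)` from `EW a`. -/
def stub_coneDense_of_even : Prop :=
  ∀ a : ℝ, 0 < a →
    (∀ o : ℝ → ℂ, Literature.NumberTheory.LFunctions.IsWeilTest o → tsupport o ⊆ Set.Icc (-a) a →
          (∀ t, o (-t) = -o t) → ∫ t, ‖o t‖ ^ 2 = (1 : ℝ) → ∀ δ : ℝ, 0 < δ →
            ∃ w : ℝ → ℂ, Literature.NumberTheory.LFunctions.IsWeilTest w ∧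
              tsupport w ⊆ Set.Icc (-a) a ∧ (∀ t, w (-t) = w t) ∧ ∫ t, ‖w t‖ ^ 2 = (1 : ℝ) ∧
              (Literature.NumberTheory.LFunctions.weilQuadratic w).re ≤
                (Literature.NumberTheory.LFunctions.weilQuadratic o).re + δ) →
    (∀ h : ℝ → ℂ, Literature.NumberTheory.LFunctions.IsWeilTest h → tsupport h ⊆ Set.Icc (-a) a →
          (∀ t, h (-t) = h t) → ∫ t, ‖h t‖ ^ 2 = (1 : ℝ) → ∀ δ : ℝ, 0 < δ →
            ∃ w : ℝ → ℂ, Literature.NumberTheory.LFunctions.IsWeilTest w ∧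
              tsupport w ⊆ Set.Icc (-a) a ∧ (∀ t, w (-t) = w t) ∧
              (∀ t, (w t).im = 0 ∧ 0 ≤ (w t).re) ∧ ∫ t, ‖w t‖ ^ 2 = (1 : ℝ) ∧
              (Literature.NumberTheory.LFunctions.weilQuadratic w).re ≤
                (Literature.NumberTheory.LFunctions.weilQuadratic h).re + δ) →
    ∀ h : ℝ → ℂ, Literature.NumberTheory.LFunctions.IsWeilTest h → tsupport h ⊆ Set.Icc (-a) a →
        ∫ t, ‖h t‖ ^ 2 = (1 : ℝ) → ∀ δ : ℝ, 0 < δ →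
          ∃ w : ℝ → ℂ, Literature.NumberTheory.LFunctions.IsWeilTest w ∧
            tsupport w ⊆ Set.Icc (-a) a ∧ (∀ t, (w t).im = 0 ∧ 0 ≤ (w t).re) ∧
            ∫ t, ‖w t‖ ^ 2 = (1 : ℝ) ∧
            (Literature.NumberTheory.LFunctions.weilQuadratic w).re ≤
              (Literature.NumberTheory.LFunctions.weilQuadratic h).re + δ

/-- **S3 `stub_coneMinimizingSeq`** (RH-free). If cone tests are dense among the normalised tests of a
genuine window `a > 0`, there is a normalised MINIMISING SEQUENCE of cone tests:
`Re Q(gₙ) → ε(a) = weilGroundEnergy a` (`bddBelow_weilQuadratic_sphere_holds`,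
`exists_weilMinimizingSeq`, squeeze). -/
def stub_coneMinimizingSeq : Prop :=
  ∀ a : ℝ, 0 < a →
    (∀ h : ℝ → ℂ, Literature.NumberTheory.LFunctions.IsWeilTest h → tsupport h ⊆ Set.Icc (-a) a →
        ∫ t, ‖h t‖ ^ 2 = (1 : ℝ) → ∀ δ : ℝ, 0 < δ →
          ∃ w : ℝ → ℂ, Literature.NumberTheory.LFunctions.IsWeilTest w ∧
            tsupport w ⊆ Set.Icc (-a) a ∧ (∀ t, (w t).im = 0 ∧ 0 ≤ (w t).re) ∧
            ∫ t, ‖w t‖ ^ 2 = (1 : ℝ) ∧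
            (Literature.NumberTheory.LFunctions.weilQuadratic w).re ≤
              (Literature.NumberTheory.LFunctions.weilQuadratic h).re + δ) →
    ∃ g : ℕ → ℝ → ℂ,
      (∀ n, Literature.NumberTheory.LFunctions.IsWeilTest (g n) ∧ tsupport (g n) ⊆ Set.Icc (-a) a ∧
        (∀ t, (g n t).im = 0 ∧ 0 ≤ (g n t).re) ∧ ∫ t, ‖g n t‖ ^ 2 = (1 : ℝ)) ∧
      Filter.Tendsto (fun n => (Literature.NumberTheory.LFunctions.weilQuadratic (g n)).re)
        Filter.atTop (nhds (Literature.NumberTheory.LFunctions.weilGroundEnergy a))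

/-- **S4 `stub_aeNonneg_of_L2_limit`** (RH-free, pure measure theory). An `L²(ℝ)`-limit of
pointwise real, non-negative functions is a.e. real and non-negative: `L²` convergence gives
convergence in measure, hence an a.e.-convergent subsequence, and `{z : ℂ | z.im = 0 ∧ 0 ≤ z.re}`
is closed. -/
def stub_aeNonneg_of_L2_limit : Prop :=
  ∀ (g : ℕ → ℝ → ℂ) (u : ℝ → ℂ), (∀ n, MeasureTheory.MemLp (g n) 2) → MeasureTheory.MemLp u 2 →
    (∀ n t, (g n t).im = 0 ∧ 0 ≤ (g n t).re) →
    Filter.Tendsto (fun n => ∫ t, ‖g n t - u t‖ ^ 2) Filter.atTop (nhds 0) →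
    ∀ᵐ t : ℝ, (u t).im = 0 ∧ 0 ≤ (u t).re

end Sig

/-! ## The stubs (the only `sorry`s of the line) -/

/-- S1 (RH-bearing, the lead's): see `Sig.stub_evenConeDense_cofinal`. -/
theorem stub_evenConeDense_cofinal : Sig.stub_evenConeDense_cofinal := by
  sorry

/-- S2 (RH-free): see `Sig.stub_coneDense_of_even`. -/
theorem stub_coneDense_of_even : Sig.stub_coneDense_of_even := by
  sorry

/-- S3 (RH-free): see `Sig.stub_coneMinimizingSeq`. -/
theorem stub_coneMinimizingSeq : Sig.stub_coneMinimizingSeq := by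
  sorry

/-- S4 (RH-free): see `Sig.stub_aeNonneg_of_L2_limit`. -/
theorem stub_aeNonneg_of_L2_limit : Sig.stub_aeNonneg_of_L2_limit := by
  sorry

/-! ## The sphere of the window: the two encodings of "minimising" agree
(refuter's `GroundBartaFloorLogic.forall_eventually_le_iff_tendsto_weilGroundEnergy`, copied — crux
workfiles are not import targets) -/

/-- `ε(a) ≤ Re Q(h)` on the normalised sphere of the window. -/
theorem weilGroundEnergy_le_of_sphere {a : ℝ} {h : ℝ → ℂ} (hh : IsWeilTest h)
    (hsupp : tsupport h ⊆ Icc (-a) a) (hnorm : ∫ t, ‖h t‖ ^ 2 = (1 : ℝ)) :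
    weilGroundEnergy a ≤ (weilQuadratic h).re :=
  csInf_le (bddBelow_weilQuadratic_sphere_holds a) ⟨h, hh, hsupp, hnorm, rfl⟩

/-- A sequence on the normalised sphere whose energies tend to `ε(a)` is eventually below every
normalised window test up to any `δ > 0` (the junk-free encoding of the route statements). -/
theorem forall_eventually_le_of_tendsto_weilGroundEnergy {a : ℝ} {g : ℕ → ℝ → ℂ}
    (H : Tendsto (fun n ↦ (weilQuadratic (g n)).re) atTop (𝓝 (weilGroundEnergy a))) :
    ∀ h : ℝ → ℂ, IsWeilTest h → tsupport h ⊆ Icc (-a) a → ∫ t, ‖h t‖ ^ 2 = (1 : ℝ) →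
      ∀ δ : ℝ, 0 < δ → ∀ᶠ n in atTop, (weilQuadratic (g n)).re ≤ (weilQuadratic h).re + δ := by
  intro h hh hsupp hnorm δ hδ
  have hle : weilGroundEnergy a ≤ (weilQuadratic h).re := weilGroundEnergy_le_of_sphere hh hsupp hnorm
  have hev : ∀ᶠ n in atTop, (weilQuadratic (g n)).re < weilGroundEnergy a + δ :=
    (tendsto_order.1 H).2 _ (by linarith)
  filter_upwards [hev] with n hn
  linarith

/-! ## The crux from the stubs -/

/-- **Composition.** `PolarPerronFrobenius` from S1–S4: at the window `a ≥ max A 1` of S1, an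
even-winning bottom gives even-cone density (S1), hence cone density (S2), hence a normalised
minimising sequence of cone tests (S3); by the compactness of the semilocal Weil form
(`ConnesConsaniMoscovici2025_thm_3_6_holds`) a subsequence converges in `L²` to some `u ∈ L²`, which is
therefore a ground state in the junk-free encoding, and `u` is a.e. real and `≥ 0` (S4). -/
theorem PolarPerronFrobenius_of (h1 : Sig.stub_evenConeDense_cofinal) (h2 : Sig.stub_coneDense_of_even)
    (h3 : Sig.stub_coneMinimizingSeq) (h4 : Sig.stub_aeNonneg_of_L2_limit) :
    Summit.RiemannHypothesis.RiemannHypothesis.Theses.GroundBarta.PolarPerronFrobenius := by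
  rw [show Summit.RiemannHypothesis.RiemannHypothesis.Theses.GroundBarta.PolarPerronFrobenius ↔
      ∀ A : ℝ, ∃ a : ℝ, A ≤ a ∧
        ((∀ o : ℝ → ℂ, IsWeilTest o → tsupport o ⊆ Icc (-a) a → (∀ t, o (-t) = -o t) →
            ∫ t, ‖o t‖ ^ 2 = (1 : ℝ) → ∀ δ : ℝ, 0 < δ → ∃ w : ℝ → ℂ, IsWeilTest w ∧
              tsupport w ⊆ Icc (-a) a ∧ (∀ t, w (-t) = w t) ∧ ∫ t, ‖w t‖ ^ 2 = (1 : ℝ) ∧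
              (weilQuadratic w).re ≤ (weilQuadratic o).re + δ) →
          ∃ u : ℝ → ℂ, (MemLp u 2 ∧ ∃ g : ℕ → ℝ → ℂ,
            (∀ n, IsWeilTest (g n) ∧ tsupport (g n) ⊆ Icc (-a) a ∧ ∫ t, ‖g n t‖ ^ 2 = (1 : ℝ)) ∧
            (∀ h : ℝ → ℂ, IsWeilTest h → tsupport h ⊆ Icc (-a) a → ∫ t, ‖h t‖ ^ 2 = (1 : ℝ) →
              ∀ δ : ℝ, 0 < δ → ∀ᶠ n in atTop, (weilQuadratic (g n)).re ≤ (weilQuadratic h).re + δ) ∧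
            Tendsto (fun n => ∫ t, ‖g n t - u t‖ ^ 2) atTop (nhds 0)) ∧
          (∀ᵐ t : ℝ, t ∈ Ioo (-a) a → (u t).im = 0 ∧ 0 ≤ (u t).re)) from Iff.rfl]
  intro A
  obtain ⟨a, ha, hS1⟩ := h1 (max A 1)
  have haA : A ≤ a := le_trans (le_max_left _ _) ha
  have ha0 : 0 < a := lt_of_lt_of_le one_pos (le_trans (le_max_right _ _) ha)
  refine ⟨a, haA, fun hEW => ?_⟩
  -- S1: even cone density at `a`; S2: cone density; S3: a minimising sequence of cone tests
  have hEven := hS1 hEW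
  have hCone := h2 a ha0 hEW hEven
  obtain ⟨g, hg, hQ⟩ := h3 a ha0 hCone
  -- compactness (CCM25 Thm 3.6, proved): an `L²`-convergent subsequence
  have hg' : ∀ n, IsWeilTest (g n) ∧ tsupport (g n) ⊆ Icc (-a) a ∧ ∫ t, ‖g n t‖ ^ 2 = (1 : ℝ) :=
    fun n => ⟨(hg n).1, (hg n).2.1, (hg n).2.2.2⟩
  obtain ⟨u, hu, φ, hφ, hconv⟩ :=
    ConnesConsaniMoscovici2025_thm_3_6_holds a ha0 g hg' hQ.bddAbove_range
  have hQ' : Tendsto (fun n ↦ (weilQuadratic (g (φ n))).re) atTop (𝓝 (weilGroundEnergy a)) :=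
    hQ.comp hφ.tendsto_atTop
  refine ⟨u, ⟨hu, fun n => g (φ n), fun n => hg' (φ n),
    forall_eventually_le_of_tendsto_weilGroundEnergy hQ', hconv⟩, ?_⟩
  -- S4: the sign survives the `L²` limit
  have hmem : ∀ n, MemLp (g (φ n)) 2 := fun n =>
    (hg (φ n)).1.1.continuous.memLp_of_hasCompactSupport (hg (φ n)).1.2
  have hsign := h4 (fun n => g (φ n)) u hmem hu (fun n t => (hg (φ n)).2.2.1 t) hconv
  exact hsign.mono fun t ht _ => ht

-- The crux modulo the four stubs: `PolarPerronFrobenius_of stub_evenConeDense_cofinal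
--   stub_coneDense_of_even stub_coneMinimizingSeq stub_aeNonneg_of_L2_limit` (not declared: the
--   skeleton audit takes exactly one theorem concluding the crux).

end Summit.RiemannHypothesis.RiemannHypothesis.Cruxes.PolarPerronFrobenius.ConeCompactness

end
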